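import Literature.Computability.AlgebraicComplexity.RectangularExponentAlpha
import Literature.Computability.AlgebraicComplexity.RectangularExponentProofs
import Summits.MatrixMultiplication.MatrixMultiplication.Theorems.SoloInformedLopsidedLadder
import HarnessLib

/-!
# The two ladders pinch the summit: `ω − 2 ≤ (1 − a)(k − 1)/(k − a)` from a left rung `a` and a right rung `k`

Solo-informed seat, gen 31 (s1, third file).  The lopsided ladder (`SoloInformedLopsidedLadder.lean`:
left rungs `ω(1,a,1) = 2`, i.e. `a ≤ α`; over `ℂ` true for `a ≤ 0.321334`) and the right ladder
(`SoloInformedTwoSidedLadder.lean`: right rungs `ω(1,1,k) = k + 1`, none known for finite `k`) are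
joined by the CONVEXITY of `q ↦ ω(1,1,q)` (Lotti–Romani 1983 §2, proved in the tree:
`omegaRect_convexOn_one_one`).  Interpolating at `q = 1` between a left rung at `a ∈ [0,1]` and a
right rung at `k > 1`:

* `omega_le_convexComb_omegaRect`: `ω ≤ ((k−1) ω(1,1,a) + (1−a) ω(1,1,k)) / (k − a)`;
* `omega_sub_two_le_of_rungs`: `ω(1,a,1) = 2 ∧ ω(1,1,k) = k+1 ⟹ ω − 2 ≤ (1−a)(k−1)/(k−a)` — the bound
  is `0` at either end of either ladder (`a = 1` or `k = 1`), so the summit is PINCHED continuously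
  from both sides; with `a = α`: `omega_sub_two_le_of_right_rung`;
* numerics: over `ℂ` (given `α ≥ 0.321334`) the first right rung alone gives only
  `ω(1,1,2) = 3 ⟹ ω ≤ 2.4043` (`omega_le_of_alpha_ge_of_omegaRect_two`, weaker than the record
  `2.371339`), but the two first rungs BEYOND the CW_q-barriers on either side — left rung 3
  (`R̃(⟨3,3,2⟩) ≤ 9`, i.e. `log_3 2 ≤ α`, barred for every `q ≥ 2`) and right rung 2 (`ω(1,1,2) = 3`,
  i.e. `R̃(⟨2,2,4⟩) ≤ 8`, barred for every `q ≥ 1`) — jointly give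
  `omega_le_of_rung_three_of_omegaRect_two : ω ≤ 2.2702 < 2.371339` over every field
  (`log_3 2 ≥ 0.63` by `3^63 < 2^100`).

Honest placement: convexity (LR83) and its use for upper bounds between known points (Huang–Pan 1998
§8, Le Gall 2012 eq. (1)) are classical; the pinching inequality is that interpolation read at the
point `q = 1` with both outer points taken on the ladders. [cite: LottiRomani1983, §2 (p. 174)]
[cite: LeGall2012, §1 eq. (1)]
-/

set_option linter.dupNamespace false

namespace Summit.MatrixMultiplication.MatrixMultiplication.Theorems

open Literature.Computability.AlgebraicComplexity

variable (K : Type) [Field K]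

/-- **Interpolation at `q = 1`** (convexity of `q ↦ ω(1,1,q)`, Lotti–Romani 1983): for
`0 ≤ a ≤ 1 < k`, `ω ≤ ((k−1)·ω(1,1,a) + (1−a)·ω(1,1,k)) / (k−a)`. [cite: LottiRomani1983, §2 (p. 174)] -/
theorem omega_le_convexComb_omegaRect {a k : ℝ} (ha0 : 0 ≤ a) (ha1 : a ≤ 1) (hk : 1 < k) :
    omega K ≤ ((k - 1) * omegaRect K 1 1 a + (1 - a) * omegaRect K 1 1 k) / (k - a) := by
  have hka : 0 < k - a := by linarith
  have hconv := (omegaRect_convexOn_one_one K).2 (Set.mem_Ici.2 ha0)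
    (Set.mem_Ici.2 (by linarith : (0 : ℝ) ≤ k)) (div_nonneg (by linarith) hka.le : 0 ≤ (k - 1) / (k - a))
    (div_nonneg (by linarith) hka.le : 0 ≤ (1 - a) / (k - a))
    (by field_simp; ring)
  simp only [smul_eq_mul] at hconv
  have e1 : (k - 1) / (k - a) * a + (1 - a) / (k - a) * k = 1 := by field_simp; ring
  rw [e1, omegaRect_one_one_one] at hconv
  rw [le_div_iff₀ hka]
  have e2 : ((k - 1) / (k - a) * omegaRect K 1 1 a + (1 - a) / (k - a) * omegaRect K 1 1 k) * (k - a) =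
      (k - 1) * omegaRect K 1 1 a + (1 - a) * omegaRect K 1 1 k := by
    field_simp
  calc omega K * (k - a) ≤ ((k - 1) / (k - a) * omegaRect K 1 1 a +
      (1 - a) / (k - a) * omegaRect K 1 1 k) * (k - a) := mul_le_mul_of_nonneg_right hconv hka.le
    _ = _ := e2

/-- **The two ladders pinch the summit**: a left rung `ω(1,a,1) = 2` (`0 ≤ a ≤ 1`) and a right rung
`ω(1,1,k) = k + 1` (`k > 1`) give `ω − 2 ≤ (1−a)(k−1)/(k−a)` — `= 0` at `a = 1` or `k = 1`.
[cite: LottiRomani1983, §2 (p. 174)] -/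
theorem omega_sub_two_le_of_rungs {a k : ℝ} (ha0 : 0 ≤ a) (ha1 : a ≤ 1) (hk : 1 < k)
    (hleft : omegaRect K 1 a 1 = 2) (hright : omegaRect K 1 1 k = k + 1) :
    omega K - 2 ≤ (1 - a) * (k - 1) / (k - a) := by
  have hka : 0 < k - a := by linarith
  have h := omega_le_convexComb_omegaRect K ha0 ha1 hk
  rw [omegaRect_one_mid_one] at hleft
  rw [hleft, hright] at h
  rw [sub_le_iff_le_add]
  calc omega K ≤ ((k - 1) * 2 + (1 - a) * (k + 1)) / (k - a) := h
    _ = (1 - a) * (k - 1) / (k - a) + 2 := by field_simp; ring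

/-- With the dual exponent itself as the left rung (`ω(1,α,1) = 2`, tree `omegaRect_dualExponentAlpha`):
**a right rung `ω(1,1,k) = k+1`, `k > 1`, gives `ω − 2 ≤ (1−α)(k−1)/(k−α)`**. [cite: LeGall2012, §1] -/
theorem omega_sub_two_le_of_right_rung {k : ℝ} (hk : 1 < k) (hright : omegaRect K 1 1 k = k + 1) :
    omega K - 2 ≤ (1 - dualExponentAlpha K) * (k - 1) / (k - dualExponentAlpha K) :=
  omega_sub_two_le_of_rungs K (dualExponentAlpha_nonneg K) (dualExponentAlpha_le_one K) hk
    (omegaRect_dualExponentAlpha K) hright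

/-- The pinching bound `(1−a)(k−1)/(k−a)` is antitone in the left rung `a ∈ [0,1]` (`k > 1`).
[folklore] -/
theorem pinch_antitone_left {a b k : ℝ} (hab : a ≤ b) (hb1 : b ≤ 1) (hk : 1 < k) :
    (1 - b) * (k - 1) / (k - b) ≤ (1 - a) * (k - 1) / (k - a) := by
  have hka : 0 < k - a := by linarith
  have hkb : 0 < k - b := by linarith
  rw [div_le_div_iff₀ hkb hka]
  nlinarith [mul_nonneg (sub_nonneg.2 hab) (mul_nonneg (sub_nonneg.2 hk.le) (sub_nonneg.2 hk.le))]

/-- Over `ℂ`, given `α ≥ 0.321334` (VWXXZ 2024): **the first right rung alone gives `ω ≤ 2.4043`**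
(`ω(1,1,2) = 3 ⟹ ω − 2 ≤ 0.678666/1.678666 < 0.4043`) — weaker than the record `ω ≤ 2.371339`.
[cite: VassilevskaWilliamsXuXuZhou2024, §1.1] -/
theorem omega_le_of_alpha_ge_of_omegaRect_two (hα : vxxz2024_alpha_ge) (h2 : omegaRect ℂ 1 1 2 = 3) :
    omega ℂ ≤ 2.4043 := by
  have h := omega_sub_two_le_of_right_rung ℂ (by norm_num : (1 : ℝ) < 2) (by rw [h2]; norm_num)
  have hmono := pinch_antitone_left (k := 2) hα (dualExponentAlpha_le_one ℂ) (by norm_num)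
  have hnum : (1 - (0.321334 : ℝ)) * (2 - 1) / (2 - 0.321334) ≤ 0.4043 := by norm_num
  linarith

/-- `0.63 ≤ log_3 2` (`3^63 < 2^100`). [folklore] -/
theorem logb_three_two_ge : (0.63 : ℝ) ≤ Real.logb 3 2 := by
  rw [Real.le_logb_iff_rpow_le (by norm_num) (by norm_num)]
  have h : ((3 : ℝ) ^ (0.63 : ℝ)) ^ (100 : ℕ) ≤ (2 : ℝ) ^ (100 : ℕ) := by
    rw [← Real.rpow_natCast, ← Real.rpow_mul (by norm_num : (0 : ℝ) ≤ 3),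
      show (0.63 : ℝ) * ((100 : ℕ) : ℝ) = ((63 : ℕ) : ℝ) by norm_num, Real.rpow_natCast]
    norm_num
  exact le_of_pow_le_pow_left₀ (by norm_num) (by norm_num) h

/-- **Left rung 3 and right rung 2 jointly beat the laser-method record** (every field): `ω(1, log_3 2, 1)
= 2` (i.e. `R̃(⟨3,3,2⟩) ≤ 9`) and `ω(1,1,2) = 3` (i.e. `R̃(⟨2,2,4⟩) ≤ 8`) give `ω ≤ 2.2702 < 2.371339`
(`ω − 2 ≤ (1 − 0.63)/(2 − 0.63) = 0.27007…`); each hypothesis is beyond every catalogued CW_q-barrier on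
its side. [cite: ChristandlLeGallLysikovZuiddam2020, §1.3.1 and §4.4] -/
theorem omega_le_of_rung_three_of_omegaRect_two (h3 : omegaRect K 1 (Real.logb 3 2) 1 = 2)
    (h2 : omegaRect K 1 1 2 = 3) : omega K ≤ 2.2702 := by
  have hl1 : Real.logb 3 2 ≤ 1 := by
    rw [Real.logb_le_iff_le_rpow (by norm_num) (by norm_num)]
    norm_num
  have hl0 : 0 ≤ Real.logb 3 2 := le_trans (by norm_num) logb_three_two_ge
  have h := omega_sub_two_le_of_rungs K hl0 hl1 (by norm_num : (1 : ℝ) < 2) h3 (by rw [h2]; norm_num)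
  have hmono := pinch_antitone_left (k := 2) logb_three_two_ge hl1 (by norm_num)
  have hnum : (1 - (0.63 : ℝ)) * (2 - 1) / (2 - 0.63) ≤ 0.2702 := by norm_num
  linarith

/-- Tensor form of the left hypothesis: **`R̃(⟨3,3,2⟩) ≤ 9 ∧ ω(1,1,2) = 3 ⟹ ω ≤ 2.2702`** (every field;
`ω(1,1,2) = 3 ⟺ R̃(⟨2,2,4⟩) ≤ 8` is `asymptoticRank_224_le_iff` of the sibling file).
[cite: ChristandlLeGallLysikovZuiddam2020, §1.3.1 and §4.4] -/
theorem omega_le_of_asymptoticRank_332_le_of_omegaRect_two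
    (h3 : asymptoticRank (matMulTensor K 3 3 2) ≤ (3 : ℝ) ^ 2) (h2 : omegaRect K 1 1 2 = 3) :
    omega K ≤ 2.2702 := by
  have h := (asymptoticRank_lopsided_le_sq_iff_omegaRect K (by norm_num : 2 ≤ 3)).1
    (by exact_mod_cast h3)
  rw [Nat.cast_ofNat] at h
  exact omega_le_of_rung_three_of_omegaRect_two K h h2

end Summit.MatrixMultiplication.MatrixMultiplication.Theorems
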